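import Mathlib
import Literature.Analysis.FluidPDE.SpaceTimeCalculus
import Summits.NavierStokesRegularity.NavierStokesRegularity.Theorems.TautLoopKelvinTautLoopLawStepVanishingOrderToolsAux
import HarnessLib

/-!
# Route `TautLoopKelvin`, crux `TautLoopLaw` (stmt-NavierStokesRegularity-15249), line
  `Sketch-ideas-r1k1` (Dini–Saks architecture) — tools stub `stub_tautLoopStepVanishingOrderTools`

**Uniform finite vanishing order.** Let `ω : ℝ → ℝ³ → ℝ³` be jointly smooth on `[a, b] × ℝ³`
(`IsSmoothSpaceTimeOn (Icc a b) ω`), real-analytic in `x` on every slice and not identically zero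
on every slice. Then there are `N : ℕ`, `c > 0`, `d₀ > 0` such that for all `s ∈ [a, b]`,
`‖x‖ ≤ R` and `0 < d ≤ d₀` some point `x'` with `‖x' - x‖ ≤ d` has `c dᴺ ≤ ‖ω s x'‖`. This is the
pure-analysis input of the skeleton stubs 6A/6B (a tiny lasso at time `s = t - h` repays a
super-exponentially small circulation deficit).

Proof (all folklore, tools in `…StepVanishingOrderToolsAux`):
1. *pointwise finite directional order* (`tautLoopVan_exists_direction`): at every `(s, x)` some
   line derivative `(d/dτ)^m ω(s, x + τ e)|_{τ=0}`, `‖e‖ ≤ 1`, is non-zero (identity principle);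
2. *local uniformity* (`tautLoopVan_local_order`): this line derivative is the iterated
   directional slice derivative `((∂_e)^m ω(s', ·))(x')`, jointly continuous in `(s', x')`
   (`tautLoopVan_isSmoothSpaceTimeOn_iterate`), so it stays `≥ c₁ > 0` in norm on a
   neighbourhood, with the same `m, e`;
3. *compactness* of `[a, b] × B̄(0, R)` (`IsCompact.elim_nhds_subcover`) gives finitely many such
   charts; `N := max m`, and uniform bounds of the `(m+1)`-st directional derivatives on
   `[a, b] × B̄(0, R + 1)` (`tautLoopVan_deriv_bound`);
4. the *quantitative line estimate* `tautLoopVan_line_lower_bound` (finite differences of the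
   Taylor polynomial + Taylor remainder) on `τ ↦ ω(s, x + τ e)` yields a sample point
   `x' = x + (k d/(m+1)) e`, `k ≤ m`, with `‖ω s x'‖ ≥ C d^m ≥ c dᴺ` (`d ≤ 1`, `m ≤ N`).
The degenerate interval `a = b` is reduced to the time-independent field `ω a` on `[a-1, a+1]`.
-/

noncomputable section

open Set Function Filter Topology

namespace Summit.NavierStokesRegularity.NavierStokesRegularity.Theorems

set_option linter.dupNamespace false

open Literature.Analysis.FluidPDE (IsSmoothSpaceTimeOn isSmoothSpaceTimeOn_const_time)

/-- **Local uniformity of the directional vanishing order.** For a jointly smooth field on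
`[a, b] × ℝ³` (`a < b`) with real-analytic, not identically vanishing slices, every point
`p = (s, x)` of `[a, b] × ℝ³` has a direction `e` (`‖e‖ ≤ 1`), an order `m`, a constant `c₁ > 0`
and a neighbourhood `V` on which `‖(d/dτ)^m ω(s', x' + τ e)|_{τ=0}‖ ≥ c₁` (joint continuity of
the iterated directional slice derivative). [folklore] -/
theorem tautLoopVan_local_order (ω : ℝ → EuclideanSpace ℝ (Fin 3) → EuclideanSpace ℝ (Fin 3))
    {a b : ℝ} (hab : a < b) (hω : IsSmoothSpaceTimeOn (Set.Icc a b) ω)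
    (han : ∀ s ∈ Set.Icc a b, AnalyticOnNhd ℝ (ω s) Set.univ)
    (hnz : ∀ s ∈ Set.Icc a b, ∃ x, ω s x ≠ 0)
    (p : ℝ × EuclideanSpace ℝ (Fin 3)) (hp : p.1 ∈ Set.Icc a b) :
    ∃ (m : ℕ) (e : EuclideanSpace ℝ (Fin 3)) (c₁ : ℝ) (V : Set (ℝ × EuclideanSpace ℝ (Fin 3))),
      ‖e‖ ≤ 1 ∧ 0 < c₁ ∧ V ∈ 𝓝 p ∧ ∀ q ∈ V, q.1 ∈ Set.Icc a b →
        c₁ ≤ ‖iteratedDeriv m (fun τ : ℝ => ω q.1 (q.2 + τ • e)) 0‖ := by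
  have hS : UniqueDiffOn ℝ (Set.Icc a b) := uniqueDiffOn_Icc hab
  obtain ⟨s, x⟩ := p
  have hs : s ∈ Set.Icc a b := hp
  obtain ⟨y, hy⟩ := hnz s hs
  obtain ⟨m, e, he, hm⟩ := tautLoopVan_exists_direction (han s hs) hy x
  have hG := (tautLoopVan_isSmoothSpaceTimeOn_iterate hω hS e m).continuousOn
  set G : ℝ → (EuclideanSpace ℝ (Fin 3)) → EuclideanSpace ℝ (Fin 3) := fun t =>
    (fun v : EuclideanSpace ℝ (Fin 3) → EuclideanSpace ℝ (Fin 3) => fun z => fderiv ℝ v z e)^[m]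
      (ω t) with hGdef
  have hval : G s x ≠ 0 := by
    have := tautLoopVan_iteratedDeriv_line e m (hω.contDiff_slice hs) x 0
    simp only [zero_smul, add_zero] at this
    rwa [this] at hm
  set c₁ : ℝ := ‖G s x‖ / 2 with hc₁
  have hnorm : 0 < ‖G s x‖ := norm_pos_iff.2 hval
  have hc₁pos : 0 < c₁ := by positivity
  have hcw : ContinuousWithinAt (uncurry G) (Set.Icc a b ×ˢ Set.univ) (s, x) :=
    hG (s, x) ⟨hs, Set.mem_univ _⟩
  have hopen : IsOpen {v : EuclideanSpace ℝ (Fin 3) | c₁ < ‖v‖} :=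
    isOpen_lt continuous_const continuous_norm
  have hmem : uncurry G ⁻¹' {v | c₁ < ‖v‖} ∈ 𝓝[Set.Icc a b ×ˢ Set.univ] (s, x) := by
    refine hcw.preimage_mem_nhdsWithin (hopen.mem_nhds ?_)
    show c₁ < ‖G s x‖
    rw [hc₁]
    linarith
  obtain ⟨V, hV, hVsub⟩ := mem_nhdsWithin_iff_exists_mem_nhds_inter.1 hmem
  refine ⟨m, e, c₁, V, he, hc₁pos, hV, ?_⟩
  rintro ⟨s', x'⟩ hq hs'
  have hq' := hVsub ⟨hq, ⟨hs', Set.mem_univ _⟩⟩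
  simp only [Set.mem_preimage, uncurry_apply_pair, Set.mem_setOf_eq] at hq'
  show c₁ ≤ ‖iteratedDeriv m (fun τ : ℝ => ω s' (x' + τ • e)) 0‖
  rw [tautLoopVan_iteratedDeriv_line e m (hω.contDiff_slice hs') x' 0]
  simp only [zero_smul, add_zero]
  exact hq'.le

/-- **Uniform bounds for the iterated directional slice derivatives** on `[a, b] × B̄(0, ρ)`
(continuity on a compact set). [folklore] -/
theorem tautLoopVan_deriv_bound (ω : ℝ → EuclideanSpace ℝ (Fin 3) → EuclideanSpace ℝ (Fin 3))
    {a b : ℝ} (hab : a < b) (hω : IsSmoothSpaceTimeOn (Set.Icc a b) ω) (ρ : ℝ) (n : ℕ)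
    (e : EuclideanSpace ℝ (Fin 3)) :
    ∃ M : ℝ, 0 ≤ M ∧ ∀ s ∈ Set.Icc a b, ∀ z : EuclideanSpace ℝ (Fin 3), ‖z‖ ≤ ρ →
      ‖((fun v : EuclideanSpace ℝ (Fin 3) → EuclideanSpace ℝ (Fin 3) => fun y => fderiv ℝ v y e)^[n]
        (ω s)) z‖ ≤ M := by
  have hG := (tautLoopVan_isSmoothSpaceTimeOn_iterate hω (uniqueDiffOn_Icc hab) e n).continuousOn
  have hK : IsCompact (Set.Icc a b ×ˢ Metric.closedBall (0 : EuclideanSpace ℝ (Fin 3)) ρ) :=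
    isCompact_Icc.prod (isCompact_closedBall 0 ρ)
  obtain ⟨M, hM⟩ := hK.exists_bound_of_continuousOn
    (hG.mono (Set.prod_mono Set.Subset.rfl (Set.subset_univ _)))
  refine ⟨max M 0, le_max_right _ _, fun s hs z hz => ?_⟩
  have := hM (s, z) ⟨hs, mem_closedBall_zero_iff.2 hz⟩
  exact this.trans (le_max_left _ _)

/-- The main statement for a non-degenerate time interval `a < b`: uniform finite vanishing
order of a jointly smooth, slice-wise analytic, slice-wise nonzero field gives
`‖ω(s, x')‖ ≥ c dᴺ` at some `x'` within distance `d` of any `x` in the ball, uniformly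
(compactness of `[a, b] × B̄(0, R)` plus the quantitative line estimate). [folklore] -/
theorem tautLoopVan_main_lt (ω : ℝ → EuclideanSpace ℝ (Fin 3) → EuclideanSpace ℝ (Fin 3))
    (a b R : ℝ) (hab : a < b) (hR : 0 < R) (hω : IsSmoothSpaceTimeOn (Set.Icc a b) ω)
    (han : ∀ s ∈ Set.Icc a b, AnalyticOnNhd ℝ (ω s) Set.univ)
    (hnz : ∀ s ∈ Set.Icc a b, ∃ x, ω s x ≠ 0) :
    ∃ N : ℕ, ∃ c : ℝ, 0 < c ∧ ∃ d₀ : ℝ, 0 < d₀ ∧ ∀ s ∈ Set.Icc a b,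
      ∀ x : EuclideanSpace ℝ (Fin 3), ‖x‖ ≤ R → ∀ d : ℝ, 0 < d → d ≤ d₀ →
        ∃ x' : EuclideanSpace ℝ (Fin 3), ‖x' - x‖ ≤ d ∧ c * d ^ N ≤ ‖ω s x'‖ := by
  set K₀ : Set (ℝ × EuclideanSpace ℝ (Fin 3)) :=
    Set.Icc a b ×ˢ Metric.closedBall (0 : EuclideanSpace ℝ (Fin 3)) R with hK₀
  have hK₀c : IsCompact K₀ := isCompact_Icc.prod (isCompact_closedBall 0 R)
  -- local data
  choose! m e c₁ V he hc₁ hV hdata using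
    fun p (hp : p ∈ K₀) => tautLoopVan_local_order ω hab hω han hnz p hp.1
  -- uniform derivative bounds
  choose M hM0 hM using fun (n : ℕ) (e' : EuclideanSpace ℝ (Fin 3)) =>
    tautLoopVan_deriv_bound ω hab hω (R + 1) n e'
  -- line constants
  choose! C hC D hD hD1 hline using fun p (hp : p ∈ K₀) =>
    tautLoopVan_line_lower_bound (F := EuclideanSpace ℝ (Fin 3)) (m p) (hc₁ p hp)
      (hM0 (m p + 1) (e p))
  -- finite subcover
  obtain ⟨t, htK, hcover⟩ := hK₀c.elim_nhds_subcover V fun p hp => hV p hp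
  have h0K : ((a, 0) : ℝ × EuclideanSpace ℝ (Fin 3)) ∈ K₀ :=
    ⟨Set.left_mem_Icc.2 hab.le, by simp [hR.le]⟩
  have hne : t.Nonempty := by
    have := hcover h0K
    simp only [Set.mem_iUnion] at this
    obtain ⟨p, hp, -⟩ := this
    exact ⟨p, hp⟩
  refine ⟨t.sup m, t.inf' hne C, (Finset.lt_inf'_iff hne).2 fun p hp => hC p (htK p hp),
    t.inf' hne D, (Finset.lt_inf'_iff hne).2 fun p hp => hD p (htK p hp), ?_⟩
  intro s hs x hx d hd hdd
  have hxK : (s, x) ∈ K₀ := ⟨hs, mem_closedBall_zero_iff.2 hx⟩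
  obtain ⟨p, hp, hpV⟩ : ∃ p ∈ t, (s, x) ∈ V p := by
    have := hcover hxK
    simp only [Set.mem_iUnion] at this
    obtain ⟨p, hp, h⟩ := this
    exact ⟨p, hp, h⟩
  have hpK : p ∈ K₀ := htK p hp
  have hd1 : d ≤ 1 := hdd.trans ((Finset.inf'_le _ hp).trans (hD1 p hpK))
  have hdD : d ≤ D p := hdd.trans (Finset.inf'_le _ hp)
  -- the line function
  set f : ℝ → EuclideanSpace ℝ (Fin 3) := fun τ => ω s (x + τ • e p) with hf
  have hfs : ContDiff ℝ (⊤ : ℕ∞) f :=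
    (hω.contDiff_slice hs).comp (contDiff_const.add (contDiff_id.smul contDiff_const))
  have hcf : c₁ p ≤ ‖iteratedDeriv (m p) f 0‖ := hdata p hpK (s, x) hpV hs
  have hMf : ∀ τ ∈ Set.Icc (0 : ℝ) 1, ‖iteratedDeriv (m p + 1) f τ‖ ≤ M (m p + 1) (e p) := by
    intro τ hτ
    rw [hf, tautLoopVan_iteratedDeriv_line (e p) (m p + 1) (hω.contDiff_slice hs) x τ]
    refine hM (m p + 1) (e p) s hs _ ?_
    calc ‖x + τ • e p‖ ≤ ‖x‖ + ‖τ • e p‖ := norm_add_le _ _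
      _ ≤ R + 1 := by
        gcongr
        rw [norm_smul, Real.norm_of_nonneg hτ.1]
        nlinarith [he p hpK, hτ.1, hτ.2, norm_nonneg (e p)]
  obtain ⟨k, hk, hbound⟩ := hline p hpK f hfs hcf hMf d hd hdD
  have hkm : (k : ℝ) ≤ m p := by exact_mod_cast Nat.lt_succ_iff.mp (Finset.mem_range.mp hk)
  refine ⟨x + ((k : ℝ) * (d / (m p + 1))) • e p, ?_, ?_⟩
  · rw [add_sub_cancel_left, norm_smul, Real.norm_of_nonneg (by positivity)]
    have h1 : (k : ℝ) * (d / (m p + 1)) ≤ d := by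
      rw [mul_div_assoc', div_le_iff₀ (by positivity)]
      nlinarith
    calc (k : ℝ) * (d / (m p + 1)) * ‖e p‖ ≤ d * 1 := by
          gcongr
          exact he p hpK
      _ = d := mul_one d
  · calc t.inf' hne C * d ^ t.sup m ≤ C p * d ^ m p :=
          mul_le_mul (Finset.inf'_le _ hp) (pow_le_pow_of_le_one hd.le hd1 (Finset.le_sup hp))
            (by positivity) (hC p hpK).le
      _ ≤ ‖f ((k : ℝ) * (d / (m p + 1)))‖ := hbound
      _ = ‖ω s (x + ((k : ℝ) * (d / (m p + 1))) • e p)‖ := by rw [hf]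

/-- **Tools stub `stub_tautLoopStepVanishingOrderTools`** (uniform finite vanishing order): for a
field `ω` jointly smooth on `[a, b] × ℝ³`, real-analytic and not identically zero on every
slice, there are `N`, `c > 0`, `d₀ > 0` such that for all `s ∈ [a, b]`, `‖x‖ ≤ R` and
`0 < d ≤ d₀` some `x'` with `‖x' - x‖ ≤ d` has `c dᴺ ≤ ‖ω s x'‖` (the degenerate interval
`a = b` is reduced to the time-independent field `ω a`). [folklore] -/
theorem stub_tautLoopStepVanishingOrderTools : ∀ (ω : ℝ → EuclideanSpace ℝ (Fin 3) →
    EuclideanSpace ℝ (Fin 3)) (a b R : ℝ), a ≤ b → 0 < R →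
    Literature.Analysis.FluidPDE.IsSmoothSpaceTimeOn (Set.Icc a b) ω →
    (∀ s ∈ Set.Icc a b, AnalyticOnNhd ℝ (ω s) Set.univ) → (∀ s ∈ Set.Icc a b, ∃ x, ω s x ≠ 0) →
    ∃ N : ℕ, ∃ c : ℝ, 0 < c ∧ ∃ d₀ : ℝ, 0 < d₀ ∧ ∀ s ∈ Set.Icc a b,
    ∀ x : EuclideanSpace ℝ (Fin 3), ‖x‖ ≤ R → ∀ d : ℝ, 0 < d → d ≤ d₀ →
    ∃ x' : EuclideanSpace ℝ (Fin 3), ‖x' - x‖ ≤ d ∧ c * d ^ N ≤ ‖ω s x'‖ := by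
  intro ω a b R hab hR hω han hnz
  rcases hab.lt_or_eq with hlt | heq
  · exact tautLoopVan_main_lt ω a b R hlt hR hω han hnz
  · subst heq
    have ha : a ∈ Set.Icc a a := ⟨le_rfl, le_rfl⟩
    have hω' : IsSmoothSpaceTimeOn (Set.Icc (a - 1) (a + 1)) (fun (_ : ℝ) x => ω a x) :=
      isSmoothSpaceTimeOn_const_time (hω.contDiff_slice ha) _
    obtain ⟨N, c, hc, d₀, hd₀, H⟩ := tautLoopVan_main_lt (fun (_ : ℝ) x => ω a x) (a - 1) (a + 1)
      R (by linarith) hR hω' (fun _ _ => han a ha) (fun _ _ => hnz a ha)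
    refine ⟨N, c, hc, d₀, hd₀, fun s hs x hx d hd hdd => ?_⟩
    have hsa : s = a := le_antisymm hs.2 hs.1
    subst hsa
    exact H s ⟨by linarith, by linarith⟩ x hx d hd hdd

end Summit.NavierStokesRegularity.NavierStokesRegularity.Theorems

end
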